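import Summits.Ventures.PercRepro.C026TwoTimesCF
import Summits.Ventures.PercRepro.C026GluingDefs

/-!
# (CF) is trivial when a mark carries no edge (p5, gen 16)

mine-3's Corollary 3 (`proofs/MINE3-PRODUCT.md` §2b) strips the components of `G − {a, b, c}`
attached to at most two marks before the product theorem; with `slackCF_gluing_nonneg` that step
is not needed, because such a part satisfies (CF) for free: if one of the marks carries no edge,
`N² = ∅`. (`a` or `b` isolated: `a ~ b` forces `a = b`, and the trivial walk avoids `D`; `c`
isolated: `D = {c}`, and an open `a`–`b` walk never meets an isolated vertex.)

* `conn_eq_of_isolated` — an isolated vertex is connected only to itself;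
* `nTwo_false_of_isolated_a`, `nTwo_false_of_isolated_b`, `nTwo_false_of_isolated_c` — `N² = ∅`;
* **`slackCF_nonneg_of_isolated`** — (CF) when some mark is isolated.
-/

namespace PercRepro

open Finset

namespace MultiGraph

section Isolated

variable {V E : Type*} {G : MultiGraph V E}

/-- An isolated vertex (no edge at it) is open-connected only to itself. -/
theorem conn_eq_of_isolated {m : V} (hm : ∀ e, ¬ G.EdgeAt e m) {ω : Config E} {v : V}
    (h : G.Conn ω m v) : v = m :=
  eq_of_conn_of_isolated (fun e _ => ⟨fun h' => hm e (Or.inl h'), fun h' => hm e (Or.inr h')⟩) h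

/-- `N² = ∅` when `a` is isolated: `a ~ b` forces `b = a`, and the trivial walk avoids `D`. -/
theorem nTwo_false_of_isolated_a {a b c : V} (ha : ∀ e, ¬ G.EdgeAt e a) (ω : Config E) :
    ¬ G.NTwo ω a b c := by
  rintro ⟨hab, _, _, hav⟩
  have := conn_eq_of_isolated ha hab
  subst this
  exact hav Relation.ReflTransGen.refl

/-- `N² = ∅` when `b` is isolated. -/
theorem nTwo_false_of_isolated_b {a b c : V} (hb : ∀ e, ¬ G.EdgeAt e b) (ω : Config E) :
    ¬ G.NTwo ω a b c := by
  rintro ⟨hab, _, _, hav⟩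
  have := conn_eq_of_isolated hb hab.symm
  subst this
  exact hav Relation.ReflTransGen.refl

/-- `N² = ∅` when `c` is isolated: `D = {c}`, and an open walk from `a` never meets `c`. -/
theorem nTwo_false_of_isolated_c {a b c : V} (hc : ∀ e, ¬ G.EdgeAt e c) (ω : Config E) :
    ¬ G.NTwo ω a b c := by
  rintro ⟨hab, hca, _, hav⟩
  apply hav
  -- every vertex reached from `a` is outside `D = {c}`: it is `a` (not in `D`) or the far end of an
  -- open edge, which cannot be `c`
  have hD : ∀ v, G.Conn ω a v → v ∉ G.cluster ωᶜ c := by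
    intro v hv hvD
    have : v = c := (conn_eq_of_isolated hc hvD).symm ▸ rfl
    subst this
    exact hca (by
      have := conn_eq_of_isolated hc hv.symm
      exact this ▸ Conn.refl _ _ _)
  unfold ConnAvoid
  refine Conn.induction (motive := fun v => Relation.ReflTransGen
    (fun x y => G.OpenAdj ω x y ∧ x ∉ G.cluster ωᶜ c ∧ y ∉ G.cluster ωᶜ c) a v)
    Relation.ReflTransGen.refl ?_ hab
  intro x y hax hxy ih
  exact ih.tail ⟨hxy, hD x hax, hD y (hax.trans (Conn.of_openAdj hxy))⟩

open Classical in
/-- **(CF) when a mark is isolated**: `N² = ∅`, so `0 ≤ Δ_CF`. -/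
theorem slackCF_nonneg_of_isolated [Fintype E] {a b c : V}
    (h : (∀ e, ¬ G.EdgeAt e a) ∨ (∀ e, ¬ G.EdgeAt e b) ∨ (∀ e, ¬ G.EdgeAt e c)) :
    0 ≤ G.slackCF a b c := by
  rw [slackCF_eq]
  have h0 : (univ.filter fun ω : Config E => G.NTwo ω a b c) = ∅ := by
    refine Finset.filter_eq_empty_iff.mpr fun ω _ => ?_
    rcases h with ha | hb | hc
    · exact nTwo_false_of_isolated_a ha ω
    · exact nTwo_false_of_isolated_b hb ω
    · exact nTwo_false_of_isolated_c hc ω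
  rw [h0, Finset.card_empty, Nat.cast_zero, sub_zero]
  positivity

end Isolated

end MultiGraph

end PercRepro
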